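import Summits.BirchSwinnertonDyer.Rank1Residual.Supersingular.X8KimLargeImageOPEN
import HarnessLib

/-!
# Class X8 (`p = 3` good supersingular, `a_3 = ±3`) under `3`-adic tower surjectivity, analytic rank
# ONE (class O3): `Ш(E/ℚ)[3^∞] = 0` and `BSD(E,3) ⟺ ord₃ #Ш_an = 0` from ONE unit Kurihara number at
# a Kolyvagin prime — CONDITIONAL on the announced Kim 2025 (arXiv:2505.09121, PREPRINT) structure
# theorem (cell `b2b-bsdres`, supersingular family, prover B = unit `b2b-bsdres-additive-p3`, gen 17;
# CLASS-CLOSURE lane §3.12, class O3 = X8 ∧ r = 1; sibling of `Supersingular/X8KimLargeImageOPEN.lean`)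

HONEST FRAMING (run/shared/lean/b2b/bsd-rank1-residual/, verbatim in every file): the goal of the
cell is to DELETE the COMBINATION-SHAPED residual classes of the Birch–Swinnerton-Dyer formula for
ALL analytic-rank `≤ 1` elliptic curves over `ℚ` — "full BSD formula for every rank `≤ 1` curve in
class `C`" assembled STRICTLY from published theorems — so that the rank-`≤ 1` remainder becomes
exactly the CONSTRUCTION-SHAPED classes, which are TYPED (missing-input `Prop`s), NOT attempted.
This is not "finishing BSD". Research route; no claim beyond the stated classes. X8 stays
CONSTRUCTION-SHAPED; per pair only; nothing about any curve is asserted; nothing is booked; no mark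
of RESIDUAL-MAP §I O3 moves. An ANNOUNCED preprint enters ONLY as an explicitly labelled OPEN
hypothesis: every theorem below carrying `hKim25r : Kim2025.…_OPEN` is CONDITIONAL on the unrefereed
arXiv:2505.09121v1 (C.-H. Kim, appendix with R. Pollack, 2025); its `p = 3` Kolyvagin-system input,
R. Sakamoto, J. Théor. Nombres Bordeaux 36 (2024) 919–946, IS refereed. Theorems only (pure
compositions of tree theorems BY NAME); no definition, no named fact minted here (debt 0).

## Contents (all per pair)

The sibling file does analytic rank `0` (N6) and the X8 bookkeeping (`three_le_of_classX8`,
`ClassX8.periodTransfer` = the PUBLISHED period transfer `realPeriodRat_eq_unit_mul_plusPeriod_three`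
at a good `3` with `E[3]` irreducible, `ClassX8.not_three_dvd_maninConstant_of_not_dvd_modularDegree` =
Česnavičius–Neururer–Saha 2024 Thm. 1.2 (A159) at `f₃ = 0`). Here, on O3 = X8 ∧ `r_an = 1` with the
`3`-adic tower (`∀ n, ρ̄_{E,3ⁿ}` onto — fed per pair by surj(3) + (ram@3), by semistability +
modularity + Ribet–Diamond, or by surj(3) + one Frobenius mod `9`, gen 16):
* `X8RankOne.card_sha_eq_one_of_kim2025_OPEN_of_kuriharaUnitPrimeAt` — `#Ш(E/ℚ)(3) = 1` from ONE unit
  Kurihara number at a PRIME Kolyvagin level (typed input `X4.KuriharaUnitPrimeAt W 3 D.f`, p199308),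
  the OPEN rank-one clause `Kim2025.rankOne_card_sha_eq_one_of_kuriharaNumber_ne_zero_of_towerSurj_OPEN`
  (p249366), GZK, the period fact, `3 ∤ c_D` — the CURRENCY of the lane's exact `3`-descent records
  on O3 (`Ш(E)[3] = 0`), from a third instrument (CLASS-CLOSURE B-4, Kurihara numbers at `3`);
* `X8RankOne.bsdp_iff_padicValRat_eq_zero_…` / `X8RankOne.bsdp_of_…` — `BSD(E,3) ⟺ ord₃ #Ш_an = 0`,
  and `BSD(E,3)` on the `ord₃ #Ш_an = 0` rows (the remaining input there is the VALUE `ord₃ #Ш_an`);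
* tower-fed forms `…_of_ram`, `…_of_semistable`, `…_of_frobenius`, and the all-binders-discharged
  conductor-level form `X8RankOne.card_sha_three_eq_one_of_kim2025_OPEN_of_frobenius_of_not_dvd_modularDegree`.
The `p ≥ 5` published twin of the first two is additive-p3's `X4/KuriharaClasswideRankOne.lean`
(Kim 2026 Thm. 1.8); the `p ≥ 3` OPEN X4 twin is n1011-p09's `Additive/X4KimLargeImageKuriharaCertificate.lean`.

NOT claimed: no class theorem; the OPEN `Prop` is a weaker-than-print shape of an UNREFEREED claim
(flag `Kim2025-OmegaE-integrality` of the Literature file applies); the 3Nn pairs of O3 (`ρ̄_{E,3}`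
not onto) have no Kolyvagin prime with cyclic `3`-part and are outside every theorem here; `BSD(E,3)`
on an O3 row still needs the value `ord₃ #Ш_an` (or the lane's index certificate). Census pointers:
O3 = 819 cells (RESIDUAL-MAP §I, R196); S-b X8 3 211 pairs, 200 3Nn. Memo:
HOME/class-closure/N6/WEEK-2026-08-28.md §2 (covers O3).

References: [Kim2025RefinedTNC] Thm. 1.1 (Str)/("BSD"), §3.2.2; [Sakamoto2024KolyvaginThree] Thm. 1.1;
[Kim2022StructureSelmer] Thm. 1.9; [CesnaviciusNeururerSaha2023] Thm. 1.2; Greenberg–Vatsal 2000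
Rem. 3.4; Serre 1968 IV §3.4; Ribet 1990 / Diamond 1995; [Miller2011LMS] Def. 1.1.
-/

noncomputable section

open scoped Classical MatrixGroups ModularForm

open CongruenceSubgroup WeierstrassCurve Literature.NumberTheory.EllipticCurves
  Literature.NumberTheory.EllipticCurves.ModularForms
  Literature.NumberTheory.EllipticCurves.Rank1Residual
  Literature.NumberTheory.EllipticCurves.Rank1Residual.Typed
  Summit.BirchSwinnertonDyer.Rank1Residual.Additive

namespace Summit.BirchSwinnertonDyer.Rank1Residual.Supersingular

variable (W : WeierstrassCurve ℚ) [W.IsElliptic] [W.IsGloballyMinimal] (p : ℕ) [hp : Fact p.Prime]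

/-! ### §2 O3 = X8 ∧ `r_an = 1` under the `3`-adic tower: `Ш(E/ℚ)[3^∞] = 0` from a prime-level unit
(OPEN input `hKim25r`) -/

/-- **X8 ∧ `r_an = 1` ∧ tower: `#Ш(E/ℚ)(3) = 1` from ONE unit Kurihara number at a PRIME Kolyvagin
level** (typed input `X4.KuriharaUnitPrimeAt W 3 D.f`: `ℓ ∈ 𝒫₁`, `#Ẽ(𝔽_ℓ)[3] ≤ 3`, `ψ_ℓ` onto,
`kuriharaNumber D.f 3 ℓ ψ ≠ 0`), CONDITIONAL on the announced Kim 2025 Thm. 1.1 (Str)/("BSD") rank-one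
clause at `p = 3` under large `3`-adic image (`hKim25r`, OPEN); GZK (`r_an = 1` forces `L(E,1) = 0`,
`Ш` finite); the period transfer DISCHARGED (`h3per`); `3 ∤ c_D`. This is the CURRENCY of the lane's
exact `3`-descent records on O3 (`Ш(E)[3] = 0`), here from a third instrument (B-4, Kurihara numbers
at `3`). Per pair; NOT a class theorem; nothing booked. [claim: Kim2025RefinedTNC, status: under-review]
[cite: Kim2025RefinedTNC, Thm. 1.1 (Str) and ("BSD") (ANNOUNCED, OPEN binder)]
[cite: Sakamoto2024KolyvaginThree, Thm. 1.1 = Thm. 4.4 (p. 920)] [cite: GreenbergVatsal2000, §3, Remark 3.4] -/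
theorem X8RankOne.card_sha_eq_one_of_kim2025_OPEN_of_kuriharaUnitPrimeAt
    (hKim25r : Kim2025.rankOne_card_sha_eq_one_of_kuriharaNumber_ne_zero_of_towerSurj_OPEN)
    (hGZK : rank_eq_analyticRank_of_analyticRank_le_one)
    (h3per : realPeriodRat_eq_unit_mul_plusPeriod_three)
    (hr : W.analyticRank = 1) (hX : ClassX8 W p)
    (htower : ∀ n : ℕ, W.HasSurjectiveModNGaloisRep (p ^ n : ℕ))
    {N : ℕ} [NeZero N] (D : ModularParametrizationData W N) (hc : ¬ (p : ℤ) ∣ D.maninConstant)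
    (hK : X4.KuriharaUnitPrimeAt W p D.f) :
    Nat.card (AddCommGroup.primaryComponent W.sha p) = 1 := by
  obtain ⟨ℓ, hℓF, hℓ, hcyc, ψ, hψ, hδ⟩ := hK
  obtain ⟨-, hfin⟩ := hGZK W (by rw [hr])
  have hL : W.entireLFunction 1 = 0 := by
    by_contra hL
    have h0 := analyticRank_eq_zero_of_entireLFunction_one_ne_zero hL
    omega
  exact hKim25r W p (three_le_of_classX8 W p hX) htower hL hr hfin D hc
    (ClassX8.periodTransfer W p h3per hX D.f D.isNewformOf) ℓ hℓ hcyc ψ hψ hδ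

/-- **X8 ∧ `r_an = 1` ∧ tower: `BSD(E,3) ⟺ ord₃ #Ш_an = 0` given a prime-level unit Kurihara
number** (`X4.KuriharaUnitPrimeAt W 3 D.f`) and the analytic order `#Ш_an = q ∈ ℚ`, CONDITIONAL on
`hKim25r` (OPEN). The remaining input on such an O3 row is the VALUE `ord₃ #Ш_an` (a per-pair number),
not a main conjecture. The `p ≥ 5` published twin is additive-p3's
`X4.bsdp_iff_padicValRat_eq_zero_of_kuriharaUnitPrimeAt_of_analyticRank_eq_one`. Per pair.
[claim: Kim2025RefinedTNC, status: under-review] [cite: Kim2025RefinedTNC, Thm. 1.1 (Str)/("BSD") (ANNOUNCED, OPEN binder)]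
[cite: Miller2011LMS, Def. 1.1] -/
theorem X8RankOne.bsdp_iff_padicValRat_eq_zero_of_kim2025_OPEN_of_kuriharaUnitPrimeAt
    (hKim25r : Kim2025.rankOne_card_sha_eq_one_of_kuriharaNumber_ne_zero_of_towerSurj_OPEN)
    (hGZK : rank_eq_analyticRank_of_analyticRank_le_one)
    (h3per : realPeriodRat_eq_unit_mul_plusPeriod_three)
    (hr : W.analyticRank = 1) (hX : ClassX8 W p)
    (htower : ∀ n : ℕ, W.HasSurjectiveModNGaloisRep (p ^ n : ℕ))
    {N : ℕ} [NeZero N] (D : ModularParametrizationData W N) (hc : ¬ (p : ℤ) ∣ D.maninConstant)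
    (hK : X4.KuriharaUnitPrimeAt W p D.f) {q : ℚ} (hq : shaAn W = (q : ℂ)) :
    BSDp W p ↔ padicValRat p q = 0 := by
  obtain ⟨hmw, hfin⟩ := hGZK W (by rw [hr])
  exact X4.bsdp_iff_padicValRat_eq_zero_of_card_primaryComponent_eq_one W p hmw hfin
    (X8RankOne.card_sha_eq_one_of_kim2025_OPEN_of_kuriharaUnitPrimeAt W p hKim25r hGZK h3per hr hX
      htower D hc hK) hq

/-- **`BSD(E,3)` on O3's `ord₃ #Ш_an = 0` rows from a prime-level unit Kurihara number** (X8 ∧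
`r_an = 1` ∧ tower ∧ `3 ∤ c_D`), CONDITIONAL on `hKim25r` (OPEN). Per pair; nothing booked.
[claim: Kim2025RefinedTNC, status: under-review] [cite: Kim2025RefinedTNC, Thm. 1.1 (ANNOUNCED, OPEN binder)]
[cite: Miller2011LMS, Def. 1.1] -/
theorem X8RankOne.bsdp_of_kim2025_OPEN_of_kuriharaUnitPrimeAt
    (hKim25r : Kim2025.rankOne_card_sha_eq_one_of_kuriharaNumber_ne_zero_of_towerSurj_OPEN)
    (hGZK : rank_eq_analyticRank_of_analyticRank_le_one)
    (h3per : realPeriodRat_eq_unit_mul_plusPeriod_three)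
    (hr : W.analyticRank = 1) (hX : ClassX8 W p)
    (htower : ∀ n : ℕ, W.HasSurjectiveModNGaloisRep (p ^ n : ℕ))
    {N : ℕ} [NeZero N] (D : ModularParametrizationData W N) (hc : ¬ (p : ℤ) ∣ D.maninConstant)
    (hK : X4.KuriharaUnitPrimeAt W p D.f) {q : ℚ} (hq : shaAn W = (q : ℂ)) (hv : padicValRat p q = 0) :
    BSDp W p :=
  (X8RankOne.bsdp_iff_padicValRat_eq_zero_of_kim2025_OPEN_of_kuriharaUnitPrimeAt W p hKim25r hGZK
    h3per hr hX htower D hc hK hq).mpr hv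

/-- **O3, tower from surj(3) + (ram@3)**: `#Ш(E/ℚ)(3) = 1` on X8 ∧ `r_an = 1` ∧ surj(3) ∧ (ram@3) ∧
`3 ∤ c_D` from a prime-level unit Kurihara number, CONDITIONAL on `hKim25r` (OPEN). Per pair.
[claim: Kim2025RefinedTNC, status: under-review] [cite: Kim2025RefinedTNC, Thm. 1.1 (ANNOUNCED, OPEN binder)]
[cite: SerreAbelianLadic1968, Ch. IV §3.4 and A.1.2] -/
theorem X8RankOne.card_sha_eq_one_of_kim2025_OPEN_of_kuriharaUnitPrimeAt_of_ram
    (hKim25r : Kim2025.rankOne_card_sha_eq_one_of_kuriharaNumber_ne_zero_of_towerSurj_OPEN)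
    (hGZK : rank_eq_analyticRank_of_analyticRank_le_one)
    (h3per : realPeriodRat_eq_unit_mul_plusPeriod_three)
    (hr : W.analyticRank = 1) (hX : ClassX8 W p) (hs : Surj W p) (hram : Ram W p)
    {N : ℕ} [NeZero N] (D : ModularParametrizationData W N) (hc : ¬ (p : ℤ) ∣ D.maninConstant)
    (hK : X4.KuriharaUnitPrimeAt W p D.f) :
    Nat.card (AddCommGroup.primaryComponent W.sha p) = 1 :=
  X8RankOne.card_sha_eq_one_of_kim2025_OPEN_of_kuriharaUnitPrimeAt W p hKim25r hGZK h3per hr hX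
    (ClassX8.towerSurj_of_surj_of_ram W p hX hs hram) D hc hK

/-- **O3 ∩ {sst}, tower from modularity + level-lowering**: `#Ш(E/ℚ)(3) = 1` on X8 ∧ sst ∧
`r_an = 1` ∧ `3 ∤ c_D` from a prime-level unit Kurihara number, CONDITIONAL on `hKim25r` (OPEN); no
certificate for the image at all. Per pair. [claim: Kim2025RefinedTNC, status: under-review]
[cite: Kim2025RefinedTNC, Thm. 1.1 (ANNOUNCED, OPEN binder)] [cite: Ribet1990, Thm. 1.1]
[cite: Diamond1995RefinedSerre, Thm. 1.1] [cite: Serre1972, §5.4 Prop. 21 i)] -/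
theorem X8RankOne.card_sha_eq_one_of_kim2025_OPEN_of_kuriharaUnitPrimeAt_of_semistable
    (hKim25r : Kim2025.rankOne_card_sha_eq_one_of_kuriharaNumber_ne_zero_of_towerSurj_OPEN)
    (hGZK : rank_eq_analyticRank_of_analyticRank_le_one)
    (h3per : realPeriodRat_eq_unit_mul_plusPeriod_three)
    (hmod' : exists_isNewformOf) (hLL : Literature.NumberTheory.Automorphic.diamond1995_refinedSerre)
    (hr : W.analyticRank = 1) (hX : ClassX8 W p) (hsst : Semistable W)
    {N : ℕ} [NeZero N] (D : ModularParametrizationData W N) (hc : ¬ (p : ℤ) ∣ D.maninConstant)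
    (hK : X4.KuriharaUnitPrimeAt W p D.f) :
    Nat.card (AddCommGroup.primaryComponent W.sha p) = 1 :=
  X8RankOne.card_sha_eq_one_of_kim2025_OPEN_of_kuriharaUnitPrimeAt W p hKim25r hGZK h3per hr hX
    (ClassX8.towerSurj_of_semistable W p hmod' hLL hX hsst) D hc hK

/-- **O3, tower from surj(3) + ONE Frobenius mod `9`**: `#Ш(E/ℚ)(3) = 1` on X8 ∧ `r_an = 1` ∧
surj(3) ∧ `3 ∤ c_D` from a prime-level unit Kurihara number and a Frobenius witness, CONDITIONAL on
`hKim25r` (OPEN). Per pair. [claim: Kim2025RefinedTNC, status: under-review]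
[cite: Kim2025RefinedTNC, Thm. 1.1 (ANNOUNCED, OPEN binder)] [cite: SerreAbelianLadic1968, Ch. IV §3.4, Lemma 3 (IV-23)] -/
theorem X8RankOne.card_sha_eq_one_of_kim2025_OPEN_of_kuriharaUnitPrimeAt_of_frobenius
    (hKim25r : Kim2025.rankOne_card_sha_eq_one_of_kuriharaNumber_ne_zero_of_towerSurj_OPEN)
    (hGZK : rank_eq_analyticRank_of_analyticRank_le_one)
    (h3per : realPeriodRat_eq_unit_mul_plusPeriod_three)
    (hr : W.analyticRank = 1) (hX : ClassX8 W p) (hs : Surj W p)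
    (ℓ : ℕ) [Fact ℓ.Prime] (hgood : W.HasGoodReductionAtPrime ℓ)
    (hℓ9 : ℓ % 9 = 2 ∨ ℓ % 9 = 5) (ha9 : W.frobeniusTrace ℓ % 9 = 3 ∨ W.frobeniusTrace ℓ % 9 = 6)
    {N : ℕ} [NeZero N] (D : ModularParametrizationData W N) (hc : ¬ (p : ℤ) ∣ D.maninConstant)
    (hK : X4.KuriharaUnitPrimeAt W p D.f) :
    Nat.card (AddCommGroup.primaryComponent W.sha p) = 1 :=
  X8RankOne.card_sha_eq_one_of_kim2025_OPEN_of_kuriharaUnitPrimeAt W p hKim25r hGZK h3per hr hX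
    (ClassX8.towerSurj_of_frobenius W p hX hs ℓ hgood hℓ9 ha9) D hc hK

/-- **O3, every binder down to certificates and named facts**: X8 ∧ `r_an = 1` at `3`, conductor-level
datum with `3 ∤ deg(D)` (A159), surj(3) + one Frobenius mod `9`, ONE unit Kurihara number at a
Kolyvagin prime ⟹ `#Ш(E/ℚ)(3) = 1`, CONDITIONAL on `hKim25r` (OPEN). Per pair; nothing booked.
[claim: Kim2025RefinedTNC, status: under-review] [cite: Kim2025RefinedTNC, Thm. 1.1 (ANNOUNCED, OPEN binder)]
[cite: CesnaviciusNeururerSaha2023, Thm. 1.2] [cite: SerreAbelianLadic1968, Ch. IV §3.4, Lemma 3 (IV-23)] -/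
theorem X8RankOne.card_sha_three_eq_one_of_kim2025_OPEN_of_frobenius_of_not_dvd_modularDegree
    (hKim25r : Kim2025.rankOne_card_sha_eq_one_of_kuriharaNumber_ne_zero_of_towerSurj_OPEN)
    (hCNS : cesnaviciusNeururerSaha_padicVal_maninConstant_le_modularDegree)
    (hGZK : rank_eq_analyticRank_of_analyticRank_le_one)
    (h3per : realPeriodRat_eq_unit_mul_plusPeriod_three)
    (hr : W.analyticRank = 1) (hX : ClassX8 W 3) (hs : Surj W 3)
    (ℓ : ℕ) [Fact ℓ.Prime] (hgood : W.HasGoodReductionAtPrime ℓ)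
    (hℓ9 : ℓ % 9 = 2 ∨ ℓ % 9 = 5) (ha9 : W.frobeniusTrace ℓ % 9 = 3 ∨ W.frobeniusTrace ℓ % 9 = 6)
    [NeZero (W.conductorNorm ℤ)] (D : ModularParametrizationData W (W.conductorNorm ℤ))
    (hdeg : ¬ 3 ∣ D.modularDegree) (hK : X4.KuriharaUnitPrimeAt W 3 D.f) :
    Nat.card (AddCommGroup.primaryComponent W.sha 3) = 1 :=
  X8RankOne.card_sha_eq_one_of_kim2025_OPEN_of_kuriharaUnitPrimeAt_of_frobenius W 3 hKim25r hGZK h3per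
    hr hX hs ℓ hgood hℓ9 ha9 D
    (by exact_mod_cast ClassX8.not_three_dvd_maninConstant_of_not_dvd_modularDegree W 3 hCNS hX D hdeg)
    hK

end Summit.BirchSwinnertonDyer.Rank1Residual.Supersingular

end
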